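import Summits.Langlands.Langlands.Theses.TowerDoorSplit
import Literature.NumberTheory.Automorphic.CaraianiNewtonModularity
import Literature.NumberTheory.Automorphic.ThorneQInfinityModular
import Literature.NumberTheory.Automorphic.AbelianTotallyRealModularity
/-! BC3 birth skeleton for support `AbelianOrCyclotomicWitnessAutomorphy` (A) of node/route `TowerDoorSplit` (lens-5 g19): 5 named stubs (sorry) + ONE closed composition `AbelianOrCyclotomicWitnessAutomorphy_proof` (real proof below the `have` lines). POST-BIRTH form: imports the route file and concludes the ROUTE decl by name (elaborates once Theses/TowerDoorSplit.lean exists). -/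
set_option linter.dupNamespace false
set_option linter.unusedVariables false
open scoped BigOperators Topology Manifold Classical MeasureTheory ProbabilityTheory Matrix InnerProductSpace ComplexConjugate ContinuousMap
open Filter Set Function TopologicalSpace MeasureTheory
-- SKELETON SHAPE (writer-1 WORD (A)(61), bus L1461): ONE closed theorem `<Crux>_proof : <crux decl>` whose `have` lines invoke the sorried stubs; no stub is typed `… → <crux decl>`.
namespace Summit.Langlands.Langlands.Cruxes.AbelianOrCyclotomicWitnessAutomorphy.Birth

/-- Yoshikawa, «On the modularity of elliptic curves over a composite field of some real quadratic fields», JNT 2019 / arXiv:1606.06597 Thm 1.2 [corpus:paper-arxiv-1606.06597 p3]: K/ℚ totally real ABELIAN Galois, 3·5·7 unramified ⇒ every E/K (Δ ≠ 0) modular.  = the NAMED tree fact `Literature.NumberTheory.Automorphic.Yoshikawa2019_theorem1_2` (module AbelianTotallyRealModularity) BY NAME — PRINT: closing = citing; the cell uses its tree corollary `.isModularEllipticCurve`. -/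
theorem stub_yoshikawa :
    Literature.NumberTheory.Automorphic.Yoshikawa2019_theorem1_2 := by
  sorry

/-- Thorne, «Elliptic curves over ℚ_∞ are modular», JEMS 21 (2019) Thm 1: every E over a layer ℚ_n^{(p)} of the cyclotomic ℤ_p-extension of ℚ is modular.  = the NAMED tree fact `Literature.NumberTheory.Automorphic.Thorne2019_thm1` (module ThorneQInfinityModular) BY NAME — PRINT. -/
theorem stub_thorne :
    Literature.NumberTheory.Automorphic.Thorne2019_thm1 := by
  sorry

/-- ETP = this route's support item `TowerDoorSplit.EllipticTransportPointwise` (BY NAME in the post-birth form, so the item is in the skeleton-aware cone of `closes` — BC6; text in the pre-birth form; text IDENTICAL to route-Langlands-CMRestImageLocusSplit's item of the same name — dedup by signature): the host transport TRANY 31038 with the witness taken through an integral model and only ITS modularity assumed.  PRINT: Arthur–Clozel solvable descent/base change + GL₁-twist + cyclic automorphic induction + strong multiplicity one, exactly as TRANY. -/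
theorem stub_transport :
    Summit.Langlands.Langlands.Theses.TowerDoorSplit.EllipticTransportPointwise := by
  sorry

/-- W⁺|₂ = host item `EllipticDegreeLadder.SatakeAvatarExistence` (stmt-Langlands-17415) AT n = 2, text VERBATIM the first antecedent of TRANY 31038 / ETP: every L-algebraic cuspidal π on GL₂/K has an irreducible ℓ-adic Galois avatar matching its Satake parameters a.e. (HLTT/Scholze + purity; over TR/CM fields print, in general open) — closes with the host item (`TowerDoorSplit.avatarTwo_of_satakeAvatarExistence`). -/
theorem stub_avatar2 :
    ∀ (K : Type) [Field K] [NumberField K] (hcpt : Literature.NumberTheory.Automorphic.isCompact_glFiniteIntegralLevel 2 K) (π : Literature.NumberTheory.Automorphic.CuspidalAutomorphicRepData 2 K hcpt), π.1.IsLAlgebraic → ∀ (ℓ : ℕ) [Fact ℓ.Prime] (ι : PadicAlgCl ℓ ≃+* ℂ), ∃ ρ : Literature.NumberTheory.GaloisRepresentations.FramedGaloisRep K (PadicAlgCl ℓ) 2, ρ.toGaloisRep.IsIrreducible ∧ ∀ᶠ v : IsDedekindDomain.HeightOneSpectrum (NumberField.RingOfIntegers K) in Filter.cofinite, SatakeFrobCompatibleAt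 ι π.1 ρ v := by
  sorry

/-- R1 = host item `EllipticDegreeLadder.RankOneAutomorphy` (stmt-Langlands-24805) BY NAME (cross-route by-name stub, tree precedent `stub_pairLBoundaryJS : AnalyticDescent.PairLBoundaryJS`) — automorphy of pinned-geometric ℓ-adic characters (class field theory + Weil); one proof closes both. -/
theorem stub_rankOne :
    Summit.Langlands.Langlands.Theses.EllipticDegreeLadder.RankOneAutomorphy := by
  sorry

/-- composition (real proof, no sorry outside the stubs): the stubs imply the cell. -/
theorem AbelianOrCyclotomicWitnessAutomorphy_proof :
    Summit.Langlands.Langlands.Theses.TowerDoorSplit.AbelianOrCyclotomicWitnessAutomorphy := by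
  have hY : (Literature.NumberTheory.Automorphic.Yoshikawa2019_theorem1_2) := stub_yoshikawa
  have hTh : (Literature.NumberTheory.Automorphic.Thorne2019_thm1) := stub_thorne
  have hT : (Summit.Langlands.Langlands.Theses.TowerDoorSplit.EllipticTransportPointwise) := stub_transport
  have hW : (∀ (K : Type) [Field K] [NumberField K] (hcpt : Literature.NumberTheory.Automorphic.isCompact_glFiniteIntegralLevel 2 K) (π : Literature.NumberTheory.Automorphic.CuspidalAutomorphicRepData 2 K hcpt), π.1.IsLAlgebraic → ∀ (ℓ : ℕ) [Fact ℓ.Prime] (ι : PadicAlgCl ℓ ≃+* ℂ), ∃ ρ : Literature.NumberTheory.GaloisRepresentations.FramedGaloisRep K (PadicAlgCl ℓ) 2, ρ.toGaloisRep.IsIrreducible ∧ ∀ᶠ v : IsDedekindDomain.HeightOneSpectrum (NumberField.RingOfIntegers K) in Filter.cofinite, SatakeFrobCompatibleAt ι π.1 ρ v) := stub_avatar2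
  have h1 : (Summit.Langlands.Langlands.Theses.EllipticDegreeLadder.RankOneAutomorphy) := stub_rankOne
  intro K _ _ hcpt ℓ _ ι ρ hirr hgeo htw hP
  obtain ⟨-, -, L, _, _, _, hgal, hsol, K₀, _, _, _, hgal₀, hsol₀, hTR, hanch, E, hEll, χ, hvia⟩ := hP
  have hΔ : E.Δ ≠ 0 := by
    intro h0
    have hu := (E.baseChange K₀).isUnit_Δ
    simp only [WeierstrassCurve.baseChange, WeierstrassCurve.map_Δ, h0, map_zero, isUnit_zero_iff] at hu
    exact zero_ne_one hu
  have hmod : Literature.NumberTheory.Automorphic.IsModularEllipticCurve K₀ E := by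
    rcases hanch with ⟨hG, hab, h3, h5, h7⟩ | ⟨p, hp, hcyc⟩
    · haveI : NumberField.IsTotallyReal K₀ := hTR
      exact hY.isModularEllipticCurve K₀ hG hab h3 h5 h7 E hΔ
    · exact hTh p hp K₀ hcyc E hΔ
  exact hT hW h1 K hcpt ℓ ι ρ hirr hgeo htw L hgal hsol K₀ hgal₀ hsol₀ E χ hvia hmod

end Summit.Langlands.Langlands.Cruxes.AbelianOrCyclotomicWitnessAutomorphy.Birth
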